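import Mathlib
import HarnessLib
import HarnessLib.Audit
import Summits.ValiantsHypothesis.Statement
import Literature.Computability.AlgebraicComplexity.ValiantConjectureEquivProofs

/-!
Route: TwoAdicLadder

DORMANT since 2026-09-03T13:37:12Z (reconciler: no traction for 5 d (last activity statement-checked at 2026-08-29T12:59:45Z); parked, not closed — `ledger route dormant route-ValiantsHypothesis-TwoAdicLadder --off` to reactivate) — unstaffed, not closed; items shared with open routes are served there. `ledger route dormant <id> --off` reactivates.

# Route TwoAdicLadder — per is det mod 2 but hard 2-adically — unbounded precision exponent over
finite chain rings plus 2-integral constants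

X = TwoIntegralNormalisation ∧ PrecisionLadder ("it suffices to show X"; in fact X ⟺ VH, see support
LadderOfVH). Call a ring R
ADMISSIBLE AT PRECISION k if it is a finite commutative principal ideal ring in which 2 is nilpotent
and 2^k ≠ 0 (= finite products of
chain rings O_K/2^m O_K, K/ℚ₂ finite, at least one with m > k, i.e. ℤ/2^{k+1} ↪ R; k = 0 admits 𝔽₂,
where per = det; principal ideals
exclude nilpotent padding such as ℤ/4[η_i]/(η_iη_j...), where ∏_i Σ_j x_ij η_j computes per_n·η₁⋯η_n
in O(n²) gates). PrecisionLadder (card C2, hardness half): for every c, for infinitely many n, SOME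
precision k makes L_R(per_n) > n^c over EVERY ring R admissible at precision k — "the exponent of
the permanent modulo 2^k is unbounded in
k". TwoIntegralNormalisation (card C1, normalisation half): if per is p-computable over ℂ then with
ONE exponent a, for all large n and
EVERY k, per_n has circuits of size ≤ n^a over some ring admissible at precision k — "VP-circuits
for per can be taken with algebraic,
2-adically integral constants and reduced modulo 2^k". Cards realised: two-adic-precision-ladder
(spine: C1 = TwoIntegralNormalisation,
C2 = PrecisionLadder, its 'algebraic Valiant ceiling' = supports
CeilingModFour/CeilingAllPrecisions), witt-carry-calculus (its k = 2
engine: support OddPermanentLift is the clean half of 'per ∈ VP_{ℤ/4} iff the odd-permutation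
polynomial is easy over 𝔽₂').
Lean: `(Literature.Computability.AlgebraicComplexity.IsPComputable (fun n =>
Literature.Computability.AlgebraicComplexity.perPoly (Fin n) ℂ) → ∃ a : ℕ, ∀ᶠ n in Filter.atTop, ∀ k
: ℕ, ∃ (R : Type) (_ : CommRing R) (_ : Fintype R), IsPrincipalIdealRing R ∧ IsNilpotent (2 : R) ∧
(2 : R) ^ k ≠ 0 ∧ Literature.Computability.AlgebraicComplexity.complexity
(Literature.Computability.AlgebraicComplexity.perPoly (Fin n) R) ≤ n ^ a) ∧ (∀ c : ℕ, ∃ᶠ n in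
Filter.atTop, ∃ k : ℕ, ∀ (R : Type) [CommRing R] [Fintype R], IsPrincipalIdealRing R → IsNilpotent
(2 : R) → (2 : R) ^ k ≠ 0 → n ^ c < Literature.Computability.AlgebraicComplexity.complexity
(Literature.Computability.AlgebraicComplexity.perPoly (Fin n) R))`

## Assembly
Pure logic plus one proved cone fact (checked sorry-free in the planner's Sketch.lean, axioms
propext/Classical.choice/Quot.sound): by
`perNotPComputableComplex_iff_holds : PerNotPComputableComplex ↔ VPNeVNPComplex` (=
ValiantsHypothesis definitionally) it suffices to
refute `IsPComputable (per over ℂ)`; assuming it, TwoIntegralNormalisation gives a and an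
eventually-true P(n) := ∀ k ∃ R adm(k),
L_R(per_n) ≤ n^a; PrecisionLadder at c := a gives frequently Q(n) := ∃ k ∀ R adm(k), n^a <
L_R(per_n); `Filter.Frequently.and_eventually`
yields n with both, and the k of Q(n) fed into P(n) gives n^a < L_R(per_n) ≤ n^a. No hub lemma and
no unproved Literature fact is used.

Rationale: WHY THIS LINE. Over 𝔽₂ the permanent IS the determinant (BurgisserClausenShokrollahi1997 (21.16);
tree `perPoly_eq_detPoly_of_charP_two`, barrier
`PermanentCharTwo`), over ℤ₂ ⊂ ℚ̄₂ ≅ ℂ it is VNP-complete; the finite chain rings of 2-adic length k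
interpolate, and L_k(n) := min over
rings admissible at precision k of L_R(per_n) is a monotone ladder from L_0(n) = L_{𝔽₂}(det_n) =
O(n^4) (Berkowitz) towards Ryser's 2^n n². Boolean
evidence that the ladder climbs: per mod 2^k of an integer matrix is computable in time n^{O(k)}
(Valiant1979Permanent §4;
BjorklundHusfeldtLyckberg2017: n^{k+O(1)}) and is hard in the parameter k (CurticapeanXia2015,
evaluation mod 2^k). What is imported:
local/2-adic commutative algebra (Witt/Galois-ring digit calculus, chain rings, reduction of
p-integral algebraic constants — the
single-prime, integrality-only shadow of Bürgisser's reduction of constants modulo primes,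
Burgisser2000 Ch. 4) and an
ultraproduct/compactness argument placing the ladder exactly at VH-strength (LadderOfVH). What it
does that TauConst/BoolTransfer do not:
their constant cruxes (TauConstElim: constant-FREE circuits; BoolGrhFree: GRH-effective Chebotarev
over all primes) are replaced by the
strictly weaker 2-INTEGRALITY at one prime ("divisions by two occur" in per's completeness proof,
arXiv:2601.00387 §2.1 p.7 — exactly the
obstruction isolated here), and the hardness half becomes a family of FIXED-POLYNOMIAL lower bounds
over FINITE rings, where counting and
efficiently computable equations for VP are legitimate (CKRST20, noted in barrier file
AlgebraicNaturalProofs) — none of which exists over ℂ.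

RANKED CRUXES. #0 LadderThesis (target) — X = TwoIntegralNormalisation ∧ PrecisionLadder as in §
Thesis (equivalent to VH by LadderOfVH and the Assembly). (why it might fail: No slack: X ⟺ VH. The
normalisation half needs elimination of the constant 1/2 (unknown over any ring where 2 is a
non-unit); the ladder's first informative rung (c = 3) is already a superlinear explicit circuit
lower bound.) [Valiant1979Permanent, Burgisser2000, Koiran2004, CurticapeanXia2015,
arXiv:2601.00387]
#2 TwoIntegralNormalisation (crux) — (card C1, finite-precision form) If the permanent family is
p-computable over ℂ, then there is a : ℕ such that for all large n and EVERY k there is a finite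
commutative principal ideal ring R with 2 nilpotent, 2^k ≠ 0 and L_R(per_n) ≤ n^a. Intended proof
shape: constants algebraic (Burgisser2000 §4.1; tree BurgisserBooleanPartsA3Steps: skeleton +
IsAlgClosed.lift), then 2-ADICALLY INTEGRAL at one prime 𝔭 | 2 of the number field K_n of the n-th
circuit at polynomial cost (the crux: eliminate division by 2), then reduce O_{K_n,𝔭} → O/2^{k+1}
(same size; any ramification/residue degree allowed — that burden sits on PrecisionLadder). Strictly
weaker than TauConst.TauConstElim (constant-free ⇒ 2-integral) and than BoolTransfer.BoolGrhFree's
needs; vacuously true if VH. [difficulty: open-problem] (why it might fail: per may be easy over ℂ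
only through division by 2: integral VNP-completeness of per holds only up to factors 2^p(n)
(Koiran2004 Thm 4.3) because per ≡ det mod 2; Ryser/Glynn normalise by 2^(1−n); no elimination of
the constant 1/2 over a ring where 2 is a non-unit is known.) [Burgisser2000 Ch. 4 §4.1 and §4.3
(field independence and reduction of algebraic constants mod p), Koiran2004 Thm 4.3 = tree
Literature.Computability.AlgebraicComplexity.Burgisser2009_thm210 (BurgisserTransfer.lean:114:
completeness of per needs the constants ±1/2), arXiv:2601.00387 §2.1 p.7 ('in the algebraic
completeness proof for the permanent divisions by two occur'), arXiv:2606.25121 §1.2 p.3 (VP_C ≠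
VNP_C ⇒ VP⁰ ≠ VNP⁰ trivial but the converse is unclear), Koiran2005, Glynn2010, tree:
Literature.Computability.AlgebraicComplexity.perNotPComputableComplex_iff_holds (hypothesis =
¬PerNotPComputableComplex ⟺ ¬VH), route TauConst item TauConstElim (stmt-ValiantsHypothesis-0335)
implies this crux] [RECORD g10 (val-width-5947-p1 g2, kernel): TwoIntegralNormalisation ⟺
HalfElimGlobal ⟺ DivElimGlobal UNCONDITIONALLY (`twoIntegralNormalisation_iff_divElimGlobal`,
Theorems/TwoAdicLadderTwoIntegralNormalisation{PrecisionUniform,UniformPrecision}.lean,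
p590915/p591173) — finite rings, precisions and heights of constants are eliminated from the crux,
which is now the bare question «can a power of 2 be divided out of a 2-adically integral circuit for
per_n at polynomial cost (eventually in n)?»; the registered stub_halfElim ⟺ DivElimUniform is
STRICTLY STRONGER (not VH-implied). MODEL TABLE = the honest open-problem placement of this crux
(HALFELIM-CENSUS-g2.md): exact division by powers of 2 is free for ΣΠ/ΠΣ/ROF/ROABP (Nisan over a
PID), IMPOSSIBLE for ΣΛΣ (kernel toy x₀x₁), OPEN exactly for VF/VBP/VP. No new cruxes from it. Lines
debt: re-register line `birth` with the lossless `stub_divElimGlobal`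
(Cruxes/TwoIntegralNormalisation/PROPOSED_LINE_divElim.lean, 1 sorry ⟺ crux) — crux-write ACL is not
the tenure seat's.]
#3 PrecisionLadder (crux) — (card C2, uniform form) For every c there are infinitely many n for
which some precision k forces n^c < L_R(per_n) for EVERY finite commutative principal ideal ring R
with 2 nilpotent and 2^k ≠ 0 (all finite chain rings GR(2^j,f)[π]/(Eisenstein), any residue degree f
and ramification). Equivalently the exponent sequence of L_k(n) = min_R L_R(per_n) is unbounded.
Restricted to R = ℤ/2^k it already says τ(per_n) = n^ω(1) witnessed 2-adically (constants of ℤ/2^k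
cost O(k) gates), i.e. it is STRONGER than Koiran's central open question; it is implied by VH
(LadderOfVH), so it cannot fail unless the summit does. First informative rung c = 3 (N^1.5 in N =
n² inputs) is beyond Baur–Strassen. [difficulty: open-problem] (why it might fail: False only with
VH (LadderOfVH). As a programme: every rung c ≥ 3 is a superlinear explicit lower bound over a
finite ring (beyond Baur–Strassen N log N); uniformity over chain rings of unbounded residue
degree/ramification is an extra 'big constants do not help' claim.) [Valiant1979Permanent §4 (per
mod 2^k of integer matrices in time O(n^{4k−3}): the Boolean shadow of the ladder),
BjorklundHusfeldtLyckberg2017 (n^{k+O(1)}), CurticapeanXia2015 (parameterized hardness of evaluation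
mod 2^k in k), BaurStrassen1983 (only superlinear general lower bound Ω(N log d)),
BurgisserClausenShokrollahi1997 Rem. (21.16)(1) (PER = DET in char 2: rung k = 0 over 𝔽₂ is easy),
tree: Literature.Barriers.ValiantsHypothesis.PermanentCharTwo / permanentCharTwo_holds
(CharacteristicTwo.lean:137 and :142),
Literature.Computability.AlgebraicComplexity.perPoly_eq_detPoly_of_charP_two
(StandardFamilies.lean:222), arXiv:1004.4960 §1 (Koiran: is τ(per_n) polynomially bounded? — implied
negative by this crux), Literature/Barriers/ValiantsHypothesis/AlgebraicNaturalProofs.lean docstring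
(CKRST20: VP-natural equations exist over constant-size finite fields — counting is fair game over
finite rings)]
#9 CeilingModFour (support) — (decisive cheap test of both cards; 'algebraic Valiant at k = 2') The
permanent modulo 4 is p-computable by DIVISION-FREE circuits over ℤ/4: IsPComputable (per_n ⊗ ℤ/4).
Expected TRUE: (a) via OddPermanentLift from a poly-size 𝔽₂-circuit for Q̄_n = Σ_{odd π} x^π =
Σ_{|T| even} HC(X_T)·det(X_{T^c}) (mod 2); or (b) by running Valiant's row-reduction for per mod 4
SYMBOLICALLY over the localisation (ℤ/4)[x][1/leading minors] (pivots generic units; correction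
terms 2·P₂ with P₂ mod 2 a Plücker/kernel expression) and removing divisions à la Strassen1973 after
a shift to a GR(4, O(log n))-point, then descending GR(4,f) → ℤ/4 by structure constants (cost f²).
Note Q̄_n is NOT VNP_{𝔽₂}-complete unless ⊕P = P (its values at 0/1 matrices are ((per − det)/2 mod
2) of the integer lift, polynomial-time by Valiant's per-mod-4 algorithm, while ⊕HamiltonianCycles
is ⊕P-complete), so the HARDNESS form of the ℤ/4 rung targets a VNP-intermediate family and is a
poor item; prove the ceiling instead. Route (b) is the planner's unverified sketch. Either outcome
re-bases the ladder (negative knowledge: nothing visible modulo 4 can prove τ(per_n)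
superpolynomial). [difficulty: M] [Valiant1979Permanent §4, BjorklundHusfeldtLyckberg2017,
Strassen1973, doi:10.1007/s00037-009-0266-4 (Braverman–Kulkarni–Roy 2009: space-efficient per mod
2^k — check for a determinant-based identity), card witt-carry-calculus (digit calculus and the Q̄_n
formula), tree: Literature.Computability.AlgebraicComplexity.isVPFamily_detPoly_of_commRing
(DetInVP.lean:470)]
#9 OddPermanentLift (support) — (witt-carry-calculus, clean direction; provable now) If the
odd-permutation polynomial Q̄_n = Σ_{sign σ = −1} ∏_i x_{iσ(i)} is p-computable over 𝔽₂ = ZMod 2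
then per_n is p-computable over ℤ/4: lift the 𝔽₂-circuit gate-by-gate to ℤ/4 (ArithCircuit.map along
any set-theoretic section; reduction mod 2 is a ring hom, so the lift computes some Q' ≡ Q mod 2,
whence 2Q' = 2Q = per − det in (ℤ/4)[x]) and add Berkowitz's division-free determinant (tree
isVPFamily_detPoly_of_commRing). [difficulty: provable-now] [BurgisserClausenShokrollahi1997 Rem.
(21.16)(1), Berkowitz1984, tree:
Literature.Computability.AlgebraicComplexity.isVPFamily_detPoly_of_commRing (DetInVP.lean:470),
Literature.Computability.AlgebraicComplexity.ArithCircuit.eval_map / complexity_add_le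
(ArithCircuit.lean), card witt-carry-calculus]
#9 CeilingAllPrecisions (support) — ('the ladder is a ladder, not a cliff'; algebraic form of
Valiant's n^{O(k)} algorithm) For every k the permanent is p-computable over ℤ/2^k by division-free
circuits (expected size n^{O(k)}; planner's unverified sketch follows): symbolic Valiant elimination
over (ℤ/2^k)[x] localised at the generic leading minors — row operations with correction terms
m!·P_m for merged rows (precision drop v₂(m+1) per merge, so multiplicities stay ≤ k + log k), base
case P_m mod 2 by compound-matrix/Plücker linear algebra — followed by Strassen's division
elimination (shift to a Teichmüller point of GR(2^k, O(k log n)) where all divisors are units;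
truncated power series need ring operations only) and structure-constant descent to ℤ/2^k.
Calibrates PrecisionLadder: its hardness must come from k → ∞. [difficulty: L] [Valiant1979Permanent
§4 (O(n^{4k−3}) value algorithm), BjorklundHusfeldtLyckberg2017, Strassen1973 (Vermeidung von
Divisionen), doi:10.1007/s00037-009-0266-4, tree:
Literature.Computability.AlgebraicComplexity.isVPFamily_detPoly_of_commRing]
#9 LadderOfVH (support) — (calibration: the ladder is not stronger than the summit; refuting
PrecisionLadder = refuting VH) ValiantsHypothesis → PrecisionLadder. Proof: if the ladder fails with
exponent c then for a.e. n and EVERY k some admissible R_{n,k} has L(per_n) ≤ n^c; the ultraproduct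
S_n = ∏_k R_{n,k}/U has 2 non-nilpotent, so S_n/P (P a prime avoiding powers of 2) is a
characteristic-0 domain over whose fraction field F_n the same-shape circuit (Łoś on finitely many
shapes) computes per_n; embed all F_n into one algebraically closed Ω of char 0 and cardinality
continuum, Ω ≃+* ℂ (Mathlib IsAlgClosed.ringEquiv_of_equiv_of_charZero), transport circuits: per is
p-computable over ℂ, ¬VH (tree perNotPComputableComplex_iff_holds). [difficulty: L] [Burgisser2000
§4.1 (VP = VNP depends only on the characteristic for algebraically closed fields), tree:
Literature.Computability.AlgebraicComplexity.perNotPComputableComplex_iff_holds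
(ValiantConjectureEquivProofs.lean), Mathlib IsAlgClosed.ringEquiv_of_equiv_of_charZero
(FieldTheory/IsAlgClosed/Classification.lean:159),
Literature.Computability.AlgebraicComplexity.ArithCircuit.eval_map]

TWO-LAYER PLAN. Foreseen glued splits (nothing filed now). PrecisionLadder ⇐ LadderZ → Descent →
PrecisionLadder, with LadderZ the same statement over the
prime rings ℤ/2^k only (constant-free flavour: '∀ c ∃ᶠ n ∃ k, n^c < L_{ℤ/2^k}(per_n)') and Descent:
'L_{ℤ/2^k}(per_n) ≤ poly(n)·L_R(per_n)
for every R admissible at precision k' (constants of big chain rings do not help superpolynomially;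
residue-degree part = the 𝔽̄₂-vs-𝔽₂
question, ramification part new). Later, once CeilingAllPrecisions is in: PrecisionLadder ⇐
DigitCost → PrecisionLadder with DigitCost
'∀ k ∃ k' > k: L_{k'}(n) ≥ n·L_k(n) eventually' (some later 2-adic digit always costs a factor n).
TwoIntegralNormalisation ⇐ AlgConst →
HalfElim → TwoIntegralNormalisation, with AlgConst the (essentially in-tree) reduction ℂ → ℚ̄ and
HalfElim the hypothesis-free uniform
form '∃ d ∀ n s k ∀ char-0 field K: L_K(per_n) ≤ s ⇒ ∃ R adm(k), L_R(per_n) ≤ (s+n)^d' (elimination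
of division by 2 at polynomial cost).

KILL CRITERIA. PrecisionLadder refuted ⇒ (LadderOfVH) VH itself is refuted — close
`refuted:PrecisionLadder` and escalate to the operator; no pivot exists.
TwoIntegralNormalisation cannot be refuted without refuting VH (it is vacuous under VH); it is
closed as UNINFORMATIVE, and the route made
dormant, if refuters show that its hypothesis-free form HalfElim fails for small n by certified
search (per_3, per_4 over ℤ/4 vs ℚ) AND no
structural 1/2-elimination idea appears within tenure. CeilingModFour/CeilingAllPrecisions REFUTED
(a cliff: per ∉ VP_{ℤ/2^k} for a
fixed k) does not kill the line — it PROVES PrecisionLadder outright for that k and is a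
breakthrough; CeilingAllPrecisions PROVED
sharpens the line (hardness only as k → ∞). TauConst.TauConstElim proved elsewhere makes crux 2 a
corollary; any proof of VH moots all.

NOT DECOMPOSED YET. The k-inductive engine for PrecisionLadder (digit/carry calculus of
witt-carry-calculus: what complexity measure grows by a factor n^δ per
2-adic digit) — deliberately not filed until CeilingAllPrecisions fixes the calibration; the
determinantal-complexity version of the ladder
(dc over ℤ/4: is dc_{ℤ/4}(per_n) > n for n ≥ 3, a 'mod-4 Pólya problem', and is a 2-adic
Mignon–Ressayre bound dc_{ℤ/4}(per_n) ≥ εn²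
true?) — weaker than the circuit ladder, candidate first rung for rank-type methods, kit-testable
for n = 3, 4; the Descent statement
(chain-ring constants vs ℤ/2^k); HalfElim (uniform 1/2-elimination); hybrid-gate {+,×,⊙,D,Frob}
lower bounds for Q̄_n over 𝔽̄₂ (witt
card T1) — parked: Q̄_n is VNP-intermediate unless ⊕P ⊆ P/poly, so value-based and
completeness-based attacks are void.

CHEAPEST FALSIFIER. (1) CeilingModFour by construction: find poly-size 𝔽₂-circuits/ABPs for Q̄_n =
Σ_{odd π} x^π (n ≤ 6 by computer search among
{det(X), det(X+Xᵀ), Pf, Hadamard squares, compound matrices}; or write out the symbolic Valiant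
elimination for k = 2) — a YES re-bases the
ladder at 8 and is publishable negative knowledge ('nothing visible mod 4 proves τ(per)
superpolynomial'); I could not run it (hub is
compute-free; no kit job filed in this one-shot unit). (2) Literature lookup: does
Braverman–Kulkarni–Roy 2009 (doi:10.1007/s00037-009-0266-4,
paywalled, acq-02334) or Valiant1979Permanent §4 already give per mod 2^k as a POLYNOMIAL IDENTITY
in determinants? If yes,
CeilingAllPrecisions is 'known' and the ladder's calibration is settled for free. (3) For crux 2's
spirit: certified search for the smallest
circuits of per_3 over ℚ with constants {±1, ±1/2} versus over ℤ/4 — a gap growing with n would be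
evidence that 1/2 is essential.

NUMBERS. Rung k = 0 (𝔽₂, i.e. 2^0 ≠ 0 only): L_{𝔽₂}(per_n) = L(det_n) = O(n^4) here (Berkowitz;
O(n^ω+o(1)) in print); rung k = 1 (ℤ/4 and all chain rings with 2 ≠ 0): unknown, see CeilingModFour.
Boolean ceilings: per mod 2^k in O(n^{4k−3})
(Valiant1979Permanent), n^{k+O(1)} (BjorklundHusfeldtLyckberg2017). General algebraic upper bound
any ring: Ryser 2^n·n². Best explicit
circuit lower bound any field: Ω(N log d) (BaurStrassen1983), i.e. rung c < 3 only. Integral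
completeness defect of per: factor 2^{p(n)}
(Koiran2004 Thm 4.3). Items at open: 8 (1 target, 2 cruxes, 4 support, 1 assembly).

DEFINITION REQUESTS. None needed to state the items (complexity, perPoly, IsPComputable over
arbitrary commutative rings; IsPrincipalIdealRing, IsNilpotent,
ZMod, Equiv.Perm.sign from Mathlib). Foreseen (not filed): `oddPermPoly n R` (Σ_{sign σ = −1} ∏
X(i,σ i)) next to perPoly/detPoly in
Literature/Computability/AlgebraicComplexity/StandardFamilies with the lemma perPoly = detPoly +
2·oddPermPoly over ℤ; a digit/carry
calculus for circuits over W₂(k) (witt-carry-calculus) if the k-inductive engine is pursued. Bib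
added this session: Valiant1979Permanent,
BjorklundHusfeldtLyckberg2017, CurticapeanXia2015. Literature wanted: acq-01595 (BHL17, cite-only),
acq-02334 (BKR09).

Novelty: Searches (2026-08-15): `lit search --hybrid "permanent modulo prime power arithmetic circuit lower
bound"` (15 book hits, none on per mod
2^k as a polynomial family); `lit search --source zbmath "permanent modulo"` (15: BHL17,
Braverman–Kulkarni–Roy 2009, Sun-type
congruences — no algebraic-circuit treatment), `… "permanent \"modulo 4\""` (1, Latin-square
parity), `… "Valiant's model cost of computing
integers constants"` (1: Koiran2004); `lit search --source s2 "permanent modulo prime power"` (10: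
BHL17 only relevant); `lit frontier
ValiantsHypothesis --since 2020` (30 rows: nothing 2-adic; arXiv:2601.00387 confirms the 1/2 gap is
open in 2026); `lit bridges
ValiantsHypothesis --cross any` (30 rows, none relevant); `lit galaxy search "permanent modulo 4"
--star all` and `"permanent modulo 2^k"
--star pdf` (0 hits / service queue timeouts); OpenAlex/arXiv/S2 partly rate-limited (429) — logged.
Card-level audits (triage-9, triage-6)
had already searched crossref/zbmath with the same null result.
Nearest prior art found: Valiant1979Permanent §4 and BjorklundHusfeldtLyckberg2017 (per mod 2^k in P
— VALUE algorithms with pivoting,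
not polynomial identities over ℤ/2^k); CurticapeanXia2015 (parameterized hardness of evaluation mod
2^k — Boolean); Burgisser2000 Ch. 4
and Koiran2004/Burgisser2009 (reduction of algebraic constants modulo primes for Boolean
consequences under GRH; integral completeness of
per up to 2^{p(n)}); on-hub: routes TauConst (TauConstElim) and BoolTransfer (Boo  [refs: 2601.00387, Koiran2004, BjorklundHusfeldtLyckberg2017, CurticapeanXia2015, Burgisser2000, Burgisser2009]

Barriers (technique_class: 2-adic-precision, finite-ring-bounds, constant-normalisation): - technique_class: 2-adic-precision, finite-ring-bounds, constant-normalisation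
- Literature.Barriers.ValiantsHypothesis.PermanentCharTwo: engaged head-on and evaded by
construction — nothing is claimed uniformly over all fields; the ladder STARTS from per = det over
𝔽₂ (rung k = 1 easy) and every hardness statement requires 2^k ≠ 0 with k ≥ 1 chosen by the
statement, i.e. lives in characteristic 2^j, j ≥ 2, where per ≠ det;
`CharacteristicFreeDcLowerBound`/`CharacteristicFreePerNotVP` are not instantiated.
- Literature.Barriers.ValiantsHypothesis.AlgebraicNaturalProofs: conditional
(SuccinctHittingSetsForVP) and stated over INFINITE fields; each rung of PrecisionLadder is a
fixed-polynomial bound over a FINITE ring, where (CKRST20, quoted in the barrier file) VP-natural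
equations for bounded-coefficient VP provably exist — so distinguisher/counting arguments are not
excluded there; conceded: for the limit k → ∞ no technique is known and the barrier's spirit (no
constructive property separating per from small circuits) is not evaded — the bet is the
self-reducible structure of per across 2-adic digits (CeilingAllPrecisions' algorithm run backwards
as a digit-cost recursion).
- Literature.Barriers.ValiantsHypothesis.RankMethods / RankLifting / ShiftedPartialsCannotSeparate /
UnpaddedShiftedPartials / PartialDerivativesDetPerm / FullRankMultilinear (rank and measure
methods): not used by the cruxes as filed; IF a rung is attacked by a rank measure over ℤ/2^k it
must be a genuin

History (route lifecycle, newest last):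
- 2026-08-15T11:58:32Z · rev 1: restated LadderThesis (stmt-ValiantsHypothesis-5946) — target LadderThesis: inline the conjunction (gate emits rank-0 before the crux decls, so the short form was BLOCKED); cosmetic: precision index k=0 is the F_2 r (planner-plancard-ValiantsHypothesis-ValiantsH-26ab82d1-0)
- 2026-08-22T20:36:51Z · DORMANT — reconciler: no traction for 5.6 d (last activity item-evidence-added at 2026-08-17T04:34:40Z); parked, not closed — `ledger route dormant route-ValiantsHypothes (operator:999:2964720)
- 2026-08-26T06:38:24Z · REACTIVATED — reconciler: reactivated — activity statement-closed at 2026-08-26T05:12:41Z after parking at 2026-08-22T20:36:51Z (operator:999:748628)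
- 2026-08-27T19:32:38Z · BROKEN — OddPerNotVPF2 (stmt-ValiantsHypothesis-21028, support) refuted by Summit.ValiantsHypothesis.ValiantsHypothesis.Theorems.TwoAdicLadderOddPerNotVPF2_refuted (refuter-ns-typeII-critic-1-g10-0)
- 2026-08-27T20:19:47Z · rev 7: dropped OddPerNotVPF2 — repair (tenure sweep g3, REPAIR DUTY (c)): OddPerNotVPF2 (stmt-21028, rank-9 SUPPORT filed by sweep g1 as rung T4) REFUTED-substantive by Theorems.TwoAdicLadder (operator:999:732328)
- 2026-08-27T20:19:47Z · REPAIRED (drop OddPerNotVPF2) — back to open: repair (tenure sweep g3, REPAIR DUTY (c)): OddPerNotVPF2 (stmt-21028, rank-9 SUPPORT filed by sweep g1 as rung T4) REFUTED-substantive by Theorems.TwoAdicLadder (operator:999:732328)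
- 2026-09-03T13:37:12Z · DORMANT — reconciler: no traction for 5 d (last activity statement-checked at 2026-08-29T12:59:45Z); parked, not closed — `ledger route dormant route-ValiantsHypothesis-T (operator:999:3327708)

sub-problem: ValiantsHypothesis · status: dormant · opened planner-plancard-ValiantsHypothesis-ValiantsH-26ab82d1-0 2026-08-15T11:43:36Z · rev 10 · ledger route-ValiantsHypothesis-TwoAdicLadder
GENERATED by the gate from the ledger (D-0016/17). Provers cite these decls: `theorem foo : Summit.ValiantsHypothesis.ValiantsHypothesis.Theses.TwoAdicLadder.<Decl> := …` in Summits/ValiantsHypothesis/ValiantsHypothesis/Theorems/<Name>.lean.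
-/

namespace Summit.ValiantsHypothesis.ValiantsHypothesis.Theses.TwoAdicLadder

open scoped BigOperators Topology Manifold Classical MeasureTheory ProbabilityTheory Matrix InnerProductSpace ComplexConjugate ContinuousMap
open Filter Set Function TopologicalSpace MeasureTheory

attribute [summit_statement] _root_.ValiantsHypothesis

open Literature.PNP

/-! Retired items kept as plain definitions (history; not obligations of this route): landed proofs / closed glue still name them. -/

-- tombstone: stmt-ValiantsHypothesis-21028 was DROPPED from this route but is still named by active items / landed proofs — kept as a plain def (no route_item tag), not an obligation of this route
/-- retired stmt-ValiantsHypothesis-21028 (dropped, gen None) — refuted by Summit.ValiantsHypothesis.ValiantsHypothesis.Theorems.TwoAdicLadderOddPerNotVPF2_refuted. -/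
def OddPerNotVPF2 : Prop :=
  ¬ Literature.Computability.AlgebraicComplexity.IsPComputable (fun n => (∑ σ ∈ (Finset.univ : Finset (Equiv.Perm (Fin n))).filter (fun σ => Equiv.Perm.sign σ = -1), ∏ i : Fin n, MvPolynomial.X (i, σ i) : MvPolynomial (Fin n × Fin n) (ZMod 2)))

-- earlier LadderThesis (stmt-ValiantsHypothesis-5946, replaced 2026-08-15T11:58:32Z -> stmt-ValiantsHypothesis-6980): retired by None — TwoIntegralNormalisation ∧ PrecisionLadder
/-- item stmt-ValiantsHypothesis-6980 · target · rank 0 · open · by planner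
why it might fail: No slack: X ⟺ VH. The normalisation half needs elimination of the constant 1/2 (unknown over any ring where 2 is a non-unit); the ladder's first informative rung (c = 3) is already a superlinear explicit circuit lower bound.
sources: Valiant1979Permanent, Burgisser2000, Koiran2004, CurticapeanXia2015, arXiv:2601.00387
[target] X = TwoIntegralNormalisation ∧ PrecisionLadder as in § Thesis (equivalent to VH by
LadderOfVH and the Assembly). -/
@[route_item "route-ValiantsHypothesis-TwoAdicLadder"]
def LadderThesis : Prop :=
  (Literature.Computability.AlgebraicComplexity.IsPComputable (fun n => Literature.Computability.AlgebraicComplexity.perPoly (Fin n) ℂ) → ∃ a : ℕ, ∀ᶠ n in Filter.atTop, ∀ k : ℕ, ∃ (R : Type) (_ : CommRing R) (_ : Fintype R), IsPrincipalIdealRing R ∧ IsNilpotent (2 : R) ∧ (2 : R) ^ k ≠ 0 ∧ Literature.Computability.AlgebraicComplexity.complexity (Literature.Computability.AlgebraicComplexity.perPoly (Fin n) R) ≤ n ^ a) ∧ (∀ c : ℕ, ∃ᶠ n in Filter.atTop, ∃ k : ℕ, ∀ (R : Type) [CommRing R] [Fintype R], IsPrincipalIdealRing R → IsNilpotent (2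 : R) → (2 : R) ^ k ≠ 0 → n ^ c < Literature.Computability.AlgebraicComplexity.complexity (Literature.Computability.AlgebraicComplexity.perPoly (Fin n) R))

/-- item stmt-ValiantsHypothesis-5947 · crux · rank 2 · open · by planner
why it might fail: per may be easy over ℂ only through division by 2: integral VNP-completeness of per holds only up to factors 2^p(n) (Koiran2004 Thm 4.3) because per ≡ det mod 2; Ryser/Glynn normalise by 2^(1−n); no elimination of the constant 1/2 over a ring where 2 is a non-unit is known.
sources: Burgisser2000 Ch. 4 §4.1 and §4.3 (field independence and reduction of algebraic constants mod p), Koiran2004 Thm 4.3 = tree Literature.Computability.AlgebraicComplexity.Burgisser2009_thm210 (BurgisserTransfer.lean:114: completeness of per needs the constants ±1/2), arXiv:2601.00387 §2.1 p.7 ('in the algebraic completeness proof for the permanent divisions by two occur'), arXiv:2606.25121 §1.2 p.3 (VP_C ≠ VNP_C ⇒ VP⁰ ≠ VNP⁰ trivial but the converse is unclear), Koiran2005, Glynn2010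
[crux] (card C1, finite-precision form) If the permanent family is p-computable over ℂ, then there
is a : ℕ such that for all large n and EVERY k there is a finite commutative principal ideal ring R
with 2 nilpotent, 2^k ≠ 0 and L_R(per_n) ≤ n^a. Intended proof shape: constants algebraic
(Burgisser2000 §4.1; tree BurgisserBooleanPartsA3Steps: skeleton + IsAlgClosed.lift), then
2-ADICALLY INTEGRAL at one prime 𝔭 | 2 of the number field K_n of the n-th circuit at polynomial
cost (the crux: eliminate division by 2), then reduce O_{K_n,𝔭} → O/2^{k+1} (same size; any
ramification/residue degree allowed — that burden sits on PrecisionLadder). Strictly weaker than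
TauConst.TauConstElim (constant-free ⇒ 2-integral) and than BoolTransfer.BoolGrhFree's needs;
vacuously true if VH. [difficulty: open-problem] -/
@[route_item "route-ValiantsHypothesis-TwoAdicLadder"]
def TwoIntegralNormalisation : Prop :=
  Literature.Computability.AlgebraicComplexity.IsPComputable (fun n => Literature.Computability.AlgebraicComplexity.perPoly (Fin n) ℂ) → ∃ a : ℕ, ∀ᶠ n in Filter.atTop, ∀ k : ℕ, ∃ (R : Type) (_ : CommRing R) (_ : Fintype R), IsPrincipalIdealRing R ∧ IsNilpotent (2 : R) ∧ (2 : R) ^ k ≠ 0 ∧ Literature.Computability.AlgebraicComplexity.complexity (Literature.Computability.AlgebraicComplexity.perPoly (Fin n) R) ≤ n ^ a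

/-- item stmt-ValiantsHypothesis-5948 · crux · rank 3 · open · by planner
why it might fail: False only with VH (LadderOfVH). As a programme: every rung c ≥ 3 is a superlinear explicit lower bound over a finite ring (beyond Baur–Strassen N log N); uniformity over chain rings of unbounded residue degree/ramification is an extra 'big constants do not help' claim.
sources: Valiant1979Permanent §4 (per mod 2^k of integer matrices in time O(n^{4k−3}): the Boolean shadow of the ladder), BjorklundHusfeldtLyckberg2017 (n^{k+O(1)}), CurticapeanXia2015 (parameterized hardness of evaluation mod 2^k in k), BaurStrassen1983 (only superlinear general lower bound Ω(N log d)), BurgisserClausenShokrollahi1997 Rem. (21.16)(1) (PER = DET in char 2: rung k = 0 over 𝔽₂ is easy), tree: Literature.Barriers.ValiantsHypothesis.PermanentCharTwo / permanentCharTwo_holds (CharacteristicTwo.lean:137 and :142)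
[crux] (card C2, uniform form) For every c there are infinitely many n for which some precision k
forces n^c < L_R(per_n) for EVERY finite commutative principal ideal ring R with 2 nilpotent and 2^k
≠ 0 (all finite chain rings GR(2^j,f)[π]/(Eisenstein), any residue degree f and ramification).
Equivalently the exponent sequence of L_k(n) = min_R L_R(per_n) is unbounded. Restricted to R =
ℤ/2^k it already says τ(per_n) = n^ω(1) witnessed 2-adically (constants of ℤ/2^k cost O(k) gates),
i.e. it is STRONGER than Koiran's central open question; it is implied by VH (LadderOfVH), so it
cannot fail unless the summit does. First informative rung c = 3 (N^1.5 in N = n² inputs) is beyond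
Baur–Strassen. [difficulty: open-problem] -/
@[route_item "route-ValiantsHypothesis-TwoAdicLadder"]
def PrecisionLadder : Prop :=
  ∀ c : ℕ, ∃ᶠ n in Filter.atTop, ∃ k : ℕ, ∀ (R : Type) [CommRing R] [Fintype R], IsPrincipalIdealRing R → IsNilpotent (2 : R) → (2 : R) ^ k ≠ 0 → n ^ c < Literature.Computability.AlgebraicComplexity.complexity (Literature.Computability.AlgebraicComplexity.perPoly (Fin n) R)

/-- item stmt-ValiantsHypothesis-5949 · support · rank 9 · closed · proved by Summit.ValiantsHypothesis.ValiantsHypothesis.Theorems.TwoAdicLadder.ceilingModFour_proof (prover) · by planner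
sources: Valiant1979Permanent §4, BjorklundHusfeldtLyckberg2017, Strassen1973, doi:10.1007/s00037-009-0266-4 (Braverman–Kulkarni–Roy 2009: space-efficient per mod 2^k — check for a determinant-based identity), card witt-carry-calculus (digit calculus and the Q̄_n formula), tree: Literature.Computability.AlgebraicComplexity.isVPFamily_detPoly_of_commRing (DetInVP.lean:470)
[support] (decisive cheap test of both cards; 'algebraic Valiant at k = 2') The permanent modulo 4
is p-computable by DIVISION-FREE circuits over ℤ/4: IsPComputable (per_n ⊗ ℤ/4). Expected TRUE: (a)
via OddPermanentLift from a poly-size 𝔽₂-circuit for Q̄_n = Σ_{odd π} x^π = Σ_{|T| even}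
HC(X_T)·det(X_{T^c}) (mod 2); or (b) by running Valiant's row-reduction for per mod 4 SYMBOLICALLY
over the localisation (ℤ/4)[x][1/leading minors] (pivots generic units; correction terms 2·P₂ with
P₂ mod 2 a Plücker/kernel expression) and removing divisions à la Strassen1973 after a shift to a
GR(4, O(log n))-point, then descending GR(4,f) → ℤ/4 by structure constants (cost f²). Note Q̄_n is
NOT VNP_{𝔽₂}-complete unless ⊕P = P (its values at 0/1 matrices are ((per − det)/2 mod 2) of the
integer lift, polynomial-time by Valiant's per-mod-4 algorithm, while ⊕HamiltonianCycles is
⊕P-complete), so the HARDNESS form of the ℤ/4 rung targets a VNP-intermediate family and is a poor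
item; prove the ceiling instead. Route (b) is the planner's unverified sketch. Either outcome
re-bases the ladder (negative knowledge: nothing visible modulo 4 can prove τ(per_n)
superpolynomial). [difficulty: M] -/
@[route_item "route-ValiantsHypothesis-TwoAdicLadder"]
def CeilingModFour : Prop :=
  Literature.Computability.AlgebraicComplexity.IsPComputable (fun n => Literature.Computability.AlgebraicComplexity.perPoly (Fin n) (ZMod 4))

-- `CeilingModFour` holds: proved by `Summit.ValiantsHypothesis.ValiantsHypothesis.Theorems.TwoAdicLadder.ceilingModFour_proof` (its module imports this route file, so no `_holds` link can be stated here).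

/-- item stmt-ValiantsHypothesis-5950 · support · rank 9 · closed · proved by Summit.ValiantsHypothesis.ValiantsHypothesis.Theorems.TwoAdicLadder.oddPermanentLift_proof (prover) · by planner
sources: BurgisserClausenShokrollahi1997 Rem. (21.16)(1), Berkowitz1984, tree: Literature.Computability.AlgebraicComplexity.isVPFamily_detPoly_of_commRing (DetInVP.lean:470), Literature.Computability.AlgebraicComplexity.ArithCircuit.eval_map / complexity_add_le (ArithCircuit.lean), card witt-carry-calculus
[support] (witt-carry-calculus, clean direction; provable now) If the odd-permutation polynomial
Q̄_n = Σ_{sign σ = −1} ∏_i x_{iσ(i)} is p-computable over 𝔽₂ = ZMod 2 then per_n is p-computable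
over ℤ/4: lift the 𝔽₂-circuit gate-by-gate to ℤ/4 (ArithCircuit.map along any set-theoretic section;
reduction mod 2 is a ring hom, so the lift computes some Q' ≡ Q mod 2, whence 2Q' = 2Q = per − det
in (ℤ/4)[x]) and add Berkowitz's division-free determinant (tree isVPFamily_detPoly_of_commRing).
[difficulty: provable-now] -/
@[route_item "route-ValiantsHypothesis-TwoAdicLadder"]
def OddPermanentLift : Prop :=
  Literature.Computability.AlgebraicComplexity.IsPComputable (fun n => (∑ σ ∈ (Finset.univ : Finset (Equiv.Perm (Fin n))).filter (fun σ => Equiv.Perm.sign σ = -1), ∏ i : Fin n, MvPolynomial.X (i, σ i) : MvPolynomial (Fin n × Fin n) (ZMod 2))) → Literature.Computability.AlgebraicComplexity.IsPComputable (fun n => Literature.Computability.AlgebraicComplexity.perPoly (Fin n) (ZMod 4))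

-- `OddPermanentLift` holds: proved by `Summit.ValiantsHypothesis.ValiantsHypothesis.Theorems.TwoAdicLadder.oddPermanentLift_proof` (its module imports this route file, so no `_holds` link can be stated here).

/-- item stmt-ValiantsHypothesis-5951 · support · rank 9 · closed · proved by Summit.ValiantsHypothesis.ValiantsHypothesis.Theorems.TwoAdicLadder.ceilingAllPrecisions_proof (prover) · by planner
sources: Valiant1979Permanent §4 (O(n^{4k−3}) value algorithm), BjorklundHusfeldtLyckberg2017, Strassen1973 (Vermeidung von Divisionen), doi:10.1007/s00037-009-0266-4, tree: Literature.Computability.AlgebraicComplexity.isVPFamily_detPoly_of_commRing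
[support] ('the ladder is a ladder, not a cliff'; algebraic form of Valiant's n^{O(k)} algorithm)
For every k the permanent is p-computable over ℤ/2^k by division-free circuits (expected size
n^{O(k)}; planner's unverified sketch follows): symbolic Valiant elimination over (ℤ/2^k)[x]
localised at the generic leading minors — row operations with correction terms m!·P_m for merged
rows (precision drop v₂(m+1) per merge, so multiplicities stay ≤ k + log k), base case P_m mod 2 by
compound-matrix/Plücker linear algebra — followed by Strassen's division elimination (shift to a
Teichmüller point of GR(2^k, O(k log n)) where all divisors are units; truncated power series need
ring operations only) and structure-constant descent to ℤ/2^k. Calibrates PrecisionLadder: its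
hardness must come from k → ∞. [difficulty: L] -/
@[route_item "route-ValiantsHypothesis-TwoAdicLadder"]
def CeilingAllPrecisions : Prop :=
  ∀ k : ℕ, Literature.Computability.AlgebraicComplexity.IsPComputable (fun n => Literature.Computability.AlgebraicComplexity.perPoly (Fin n) (ZMod (2 ^ k)))

-- `CeilingAllPrecisions` holds: proved by `Summit.ValiantsHypothesis.ValiantsHypothesis.Theorems.TwoAdicLadder.ceilingAllPrecisions_proof` (its module imports this route file, so no `_holds` link can be stated here).

/-- item stmt-ValiantsHypothesis-5952 · support · rank 9 · closed · proved by Summit.ValiantsHypothesis.ValiantsHypothesis.Theorems.TwoAdicLadder.ladderOfVH_proof (prover) · by planner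
sources: Burgisser2000 §4.1 (VP = VNP depends only on the characteristic for algebraically closed fields), tree: Literature.Computability.AlgebraicComplexity.perNotPComputableComplex_iff_holds (ValiantConjectureEquivProofs.lean), Mathlib IsAlgClosed.ringEquiv_of_equiv_of_charZero (FieldTheory/IsAlgClosed/Classification.lean:159), Literature.Computability.AlgebraicComplexity.ArithCircuit.eval_map
[support] (calibration: the ladder is not stronger than the summit; refuting PrecisionLadder =
refuting VH) ValiantsHypothesis → PrecisionLadder. Proof: if the ladder fails with exponent c then
for a.e. n and EVERY k some admissible R_{n,k} has L(per_n) ≤ n^c; the ultraproduct S_n = ∏_k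
R_{n,k}/U has 2 non-nilpotent, so S_n/P (P a prime avoiding powers of 2) is a characteristic-0
domain over whose fraction field F_n the same-shape circuit (Łoś on finitely many shapes) computes
per_n; embed all F_n into one algebraically closed Ω of char 0 and cardinality continuum, Ω ≃+* ℂ
(Mathlib IsAlgClosed.ringEquiv_of_equiv_of_charZero), transport circuits: per is p-computable over
ℂ, ¬VH (tree perNotPComputableComplex_iff_holds). [difficulty: L] -/
@[route_item "route-ValiantsHypothesis-TwoAdicLadder"]
def LadderOfVH : Prop :=
  ValiantsHypothesis → PrecisionLadder

-- `LadderOfVH` holds: proved by `Summit.ValiantsHypothesis.ValiantsHypothesis.Theorems.TwoAdicLadder.ladderOfVH_proof` (its module imports this route file, so no `_holds` link can be stated here).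

/-- item stmt-ValiantsHypothesis-5953 · assembly · rank 1 · closed · proved by Summit.ValiantsHypothesis.ValiantsHypothesis.Theorems.TwoAdicLadder.assembly_proof (prover) · by planner
sources: tree: Literature.Computability.AlgebraicComplexity.perNotPComputableComplex_iff_holds (ValiantConjectureEquivProofs.lean), Mathlib Filter.Frequently.and_eventually (Order/Filter/Basic.lean:781), Burgisser2000 Rem. 2.11 / Thm. 2.10
[assembly] PrecisionLadder → TwoIntegralNormalisation → ValiantsHypothesis (via
perNotPComputableComplex_iff_holds and Frequently.and_eventually; one screen). -/
@[route_item "route-ValiantsHypothesis-TwoAdicLadder"]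
def Assembly : Prop :=
  PrecisionLadder → TwoIntegralNormalisation → ValiantsHypothesis

-- `Assembly` holds: proved by `Summit.ValiantsHypothesis.ValiantsHypothesis.Theorems.TwoAdicLadder.assembly_proof` (its module imports this route file, so no `_holds` link can be stated here).

-- records of items no longer active in this route (dropped / restated):
-- earlier OddPerNotVPF2 (stmt-ValiantsHypothesis-21028, dropped 2026-08-27T20:19:47Z): refuted by Summit.ValiantsHypothesis.ValiantsHypothesis.Theorems.TwoAdicLadderOddPerNotVPF2_refuted — ¬ Literature.Computability.AlgebraicComplexity.IsPComputable (fun n => (∑ σ ∈ (Finset.univ : Finset (Equiv.Perm (Fin n))).filter (fun σ => Equiv.Perm.sign σ = -1), ∏ i : Fin n, MvPolynomial.X (i, σ i) : MvPolynomi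

/-! D-0027 §2.1 — DECIDING THEOREM (planner-authored via `route open/edit --closes-file`; by planner-rbadge-ValiantsHypothesis-TwoAdicLadde-cbf1d479-0 2026-08-15T20:50:43Z):
its hypotheses are this route's items and its conclusion the sub-problem Statement (glue_lint), and it elaborates with this file. -/

@[closes "route-ValiantsHypothesis-TwoAdicLadder"] theorem closes (h₂ : TwoIntegralNormalisation) (h₃ : PrecisionLadder) : _root_.ValiantsHypothesis := by
  -- VH := VP ℂ ≠ VNP ℂ. If VP ℂ = VNP ℂ then per is p-computable over ℂ
  -- (isPComputable_perPoly_complex_iff, proved in ValiantConjectureEquivProofs: VNP-completeness of per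
  -- in characteristic ≠ 2 + closure of VP under p-projections); TwoIntegralNormalisation then gives one
  -- exponent a with, eventually in n, cheap circuits for per_n at EVERY precision k, while PrecisionLadder
  -- at c := a gives, frequently in n, SOME precision k at which every admissible ring needs > n^a gates;
  -- Frequently.and_eventually produces an n with both, and feeding that k back yields n^a < L ≤ n^a.
  unfold _root_.ValiantsHypothesis Literature.PNP.ValiantHypothesis
  intro hEq
  have hP : Literature.Computability.AlgebraicComplexity.IsPComputable
      (fun n => Literature.Computability.AlgebraicComplexity.perPoly (Fin n) ℂ) :=
    Literature.Computability.AlgebraicComplexity.isPComputable_perPoly_complex_iff.2 hEq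
  obtain ⟨a, ha⟩ := h₂ hP
  obtain ⟨n, ⟨k, hk⟩, hn⟩ := ((h₃ a).and_eventually ha).exists
  obtain ⟨R, _, _, hPIR, hnil, hne, hle⟩ := hn k
  exact absurd hle (_root_.not_le.mpr (hk R hPIR hnil hne))

end Summit.ValiantsHypothesis.ValiantsHypothesis.Theses.TwoAdicLadder
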